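import Summits.SmoothPoincare4.SmoothPoincare4.Theses.WeakReductionDescent
import Literature.Topology.FourManifolds.WeaklyReducibleTrisections
import Literature.Topology.FourManifolds.WeaklyReducibleTrisectionsNaturality
import Literature.Topology.FourManifolds.SphereTrisectionsSectors
import Literature.Topology.FourManifolds.TrisectionFunctorGKNaturality
import Literature.Topology.FourManifolds.TrisectionsStabilization
import Summits.SmoothPoincare4.SmoothPoincare4.Theorems.WeakReductionDescentMinimalWeaklyReducibleFromFourStubPigeonhole
import Summits.SmoothPoincare4.SmoothPoincare4.Theorems.WeakReductionDescentMinimalWeaklyReducibleFromFourStubTwoSided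
import Summits.SmoothPoincare4.SmoothPoincare4.Theorems.WeakReductionDescentMinimalWeaklyReducibleFromFourReduction
import Summits.SmoothPoincare4.SmoothPoincare4.Theorems.WeakReductionReduces.Negative.RefutationCost

/-!
# Disproof of `MinimalWeaklyReducibleFromFour` (X₂, stmt-SmoothPoincare4-18019) — findings: NO KILL SHORT OF
# `¬ SmoothPoincare4` (crux SPC4-vacuous on every `M ≅ S⁴`); the picked line `Sketch` (spine KCap) DISCARDS
# minimality and its apex `stub_sectorHaken` is NON-VACUOUS ON THE ROUND `S⁴` ((6;2,2,2) exists, proved),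
# decides that every genus-≥4 trisection of `S⁴` is weakly reducible (open in print), is implied by
# SPC4 ∧ 4-D Waldhausen and killable only by a NON-STANDARD trisection of `S⁴` or an exotic sphere;
# `2 ≤ k p` is load-bearing in it, `4 ≤ g` is not (cdisprove seat, cycle 1, 2026-08-17)

Crux X₂ (`Theses.WeakReductionDescent.MinimalWeaklyReducibleFromFour`): for every smooth homotopy 4-sphere
`M` (bare binders + `e : M ≃ₕ S⁴`) and every Gay–Kirby trisection `T` of genus `g ≥ 4` of MINIMAL genus for
`M`, `T` is weakly reducible (Aranda–Zupan: disjoint non-separating `c`, `c′` on `F`, `c` compressing in one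
handlebody of the spine, `c′` in the other two).  X₂ is K1 (`MinimalWeaklyReducible`) verbatim for `4 ≤ g`.

## Prior negative work used (cited, not redone)

* `Cruxes/MinimalWeaklyReducibleFromFour/BirthAttack.lean` (refuter-rattack-…-18019-0, sorry-free): SHIELD
  `SmoothPoincare4 → X₂` by vacuity (round `S⁴`'s genus-0 trisection pulled back along the diffeomorphism
  makes "minimal of genus ≥ 1" false), kill criterion (= exotic `S⁴` with a strongly irreducible minimal
  trisection of genus ≥ 4), exactness `K1 ↔ K1@3 ∧ X₂`, threshold analysis, `IsGKTrisection` load-bearing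
  (empty sectors), encoding faithful to AZ25 p. 6 / Remark 2.5; paper mutations: drop `e` ⇒ false at
  `#⁴ℂP²` (4;0,0,0) (no cores when `Σk = 0`); drop minimality ⇒ 4-D Waldhausen territory.
* `Cruxes/WeakReductionReduces/Disproof.lean` + `Theorems/WeakReductionReduces/Negative/RefutationCost.lean`
  (sibling K2 seat): encoding audit of `BoundsDisc`/`IsCurve`/`𝔻²` atlas (no junk), `not_minimal_of_diffeomorph`.
  LANDED by this seat (re-using them): `Theorems/MinimalWeaklyReducibleFromFour/Negative/RefutationCost.lean`
  (p169010, ACCEPTED, commit 161881a1003a: ¬X₂→¬SPC4, ¬X₂→¬K1, exotic sector, strongest-variant sandwich) and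
  `Theorems/MinimalWeaklyReducibleFromFour/Negative/SectorHakenCost.lean` (p169031, ACCEPTED, commit
  2c8990d27355: the §B theorems below, importable by the lead / planners).

## §A  The crux itself — why no model, finite or junk, can kill it (formal, short)

`fromFour_of_spc4`, `not_spc4_of_not_fromFour`: an unconditional `¬ X₂` is an exotic 4-sphere.  Every `M`
the tree can build with `e : M ≃ₕ S⁴` is diffeomorphic to `S⁴`, where minimality of genus ≥ 1 fails
(`sphere_not_isMinimal`).  Verdict: refuted-* impossible; negative-lemma-modulo-H pointless (H = ¬SPC4-strength).

## §B  TARGETS = the picked line `Sketch` (spine A, KCap; PICKED.md) — the apex `stub_sectorHaken`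

The skeleton closes X₂ from `stub_pigeonhole` (LANDED), `stub_twoSided` (LANDED) and the apex (open).
* `kcapNoMin_of_sectorHaken`, `fromFour_of_kcapNoMin`: the composition NEVER CONSUMES MINIMALITY — the line
  proves the minimality-free `KCapNoMin` (every GK-trisection of genus ≥ 4 of a homotopy 4-sphere is weakly
  reducible), strictly between the apex and X₂.  Joint sufficiency has no gap (sorry-free upstream).
* NON-VACUITY (`sphere_gkTrisection_six_two`, `sectorHaken_hypotheses_satisfiable`): GK genus-0 trisection of
  the ROUND `S⁴` (PROVED) stabilised twice (`IsGKTrisection.exists_stabilization`, PROVED) is a (6;2,2,2)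
  GK-trisection of `S⁴`: `g = 6 ≥ 4`, `k p = 2` at EVERY label.  So the apex's hypotheses hold on `S⁴`
  itself — the summit does NOT discharge the apex (contrast §A).  (This corrects BirthAttack's remark that
  "drop minimality has no formal witness class": it has, stabilisation is proved in the tree.)
* WHAT THE APEX DECIDES (`sphere_isWeaklyReducible_of_sectorHaken`): every GK-trisection of the ROUND `S⁴` of
  genus ≥ 4 is weakly reducible.  OPEN IN PRINT: "A major open problem in trisection theory is whether there
  exists a non-standard trisection of S⁴; that is, whether every trisection of S⁴ is a(n unbalanced)
  stabilization of the genus-zero trisection … current techniques for obstructing reducibility of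
  non-minimal trisections are limited" (AZ25 = arXiv:2503.04607, p. 27 L14–22, read in the held text);
  Q8.3 (ibid. L23–25) asks for strongly irreducible genus-3 trisections (candidates: double branched covers
  of twist-spun 2-bridge knots, `≅ S⁴` or `S_p`).
* SHIELD OF THE APEX (paper + `sectorHaken_of_sphere_of_smoothPoincare4`, formal): under SPC4 the apex is
  EXACTLY its restriction `SectorHakenSphere` to the round sphere (transport along `Φ : M ≅ S⁴` of curves,
  discs, non-separation, two-sides clause — naturality lemmas PROVED in the tree).  On paper
  `Waldhausen4D → SectorHakenSphere`: a STANDARD trisection of `S⁴` = `#` of genus-1 trisections of types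
  (1;1,0,0), (1;0,1,0), (1;0,0,1) with multiplicities `k₀,k₁,k₂`; at a label `p` with `k p ≥ 2` take two
  type-`p` summands `A₁`, `A₂` (in a type-`p` summand `H_q`, `H_r` share their meridian `aᵢ`, and `H_p`'s
  meridian `bᵢ` meets `aᵢ` once), `δ` := the connected-sum curve separating `A₁ ∪ (anything)` from
  `A₂ ∪ (rest)` (bounds discs in all three handlebodies, separating, `a₁`, `a₂` on different sides),
  `c₁ := a₁`, `c₂ := a₂`, `c := b₁` (non-separating, compresses in `H_p`, misses `δ`).  Hence
  `SPC4 ∧ Waldhausen4D → apex`, and a KILL of the apex is an exotic `S⁴` or a NON-STANDARD TRISECTION OF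
  `S⁴` — the lead's test family (MZ18's (4;0,2,2)-trisections of `S⁴` from GST R-links) consists exactly of
  the standing potential counterexamples to Waldhausen4D; a bounded search there can CONFIRM the
  configuration (find `δ`, `c`), never refute it: "no balanced `δ` admits a disjoint `p`-compressing curve"
  is a distance-≥2 statement between the disc set `𝒟(H_p)` and the doubly-compressing set
  `𝒟(H_q) ∩ 𝒟(H_r)` over infinitely many curves, with no finite certificate known (AZ25 p. 27).  No compute
  job was submitted for that reason (kit_allowed, nothing certifiable).
* LOAD-BEARING HYPOTHESES OF THE APEX.  `IsGKTrisection`: load-bearing, FORMAL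
  (`sectorHaken_false_without_trisection`, empty sectors).  `2 ≤ k p`: load-bearing ON PAPER
  (`sectorHaken_false_without_kp`, sorried): the two-sides clause forces `δ` SEPARATING with a core on each
  side (`sectorHaken_sides_consequences`, formal); for `k p ≤ 1` a separating reducing sphere `S_δ` of
  `∂X_p ≅ #^{k p}(S¹×S²)` (prime or `S³`) bounds a punctured `S³` on one side, whose cores would compress to
  both sides of a Heegaard surface of `S³` and hence be separating — contradiction; witness the (4;1,1,2)
  or (6;2,2,2)-relabelled… any trisection of `S⁴` with a label `k p = 1`, e.g. (4;2,1,1) at `p = 1`.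
  `4 ≤ g`: NOT load-bearing given `2 ≤ k p` (the (2;2,0,0) and (3;2,1,0) stabilisations of `S⁴` carry the
  configuration by the recipe above) — information for the lead: the apex could be stated for all `g`.
  `e : M ≃ₕ S⁴`: used only through pigeonhole (`g = Σk`); for the apex proper (given `k p ≥ 2`) no paper
  counterexample among standard-like trisections of other 4-manifolds was found.
* STUB MIS-STATEMENT AUDIT: none.  `Trisection.IsCurve/BoundsDisc/IsNonSeparating/spineHandlebody` are the
  tree's (Iff.rfl to the crux clause); the sides clause quantifies over ALL preconnected `S ⊆ F ∖ δ`
  (equivalent to "different components"); `c` may meet `c₁`, `c₂` (intended: two-sidedness picks the far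
  core).  No `stub-false` / `stub-misstated` note is warranted; the evidence note records the shield.

## §C  Near-misses kept as `sorry` (paper witnesses, not formalisable: no Jordan–Schoenflies / Waldhausen /
## `ℂP²` in the tree): `fromFour_false_without_homotopyEquiv`, `sectorHaken_false_without_kp`,
## `sectorHakenSphere_of_waldhausen4D` (statement only, `Waldhausen4D` left abstract as a hypothesis shape).

WHY IT RESISTS: X₂ quantifies over MINIMAL trisections of HOMOTOPY SPHERES, a class empty on every
constructible `M`; the line's apex trades that shield for the 4-D Waldhausen shield — it speaks about `S⁴`'s
own genus-≥4 trisections, where every standard one complies and no non-standard one is known to exist.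
-/

noncomputable section

set_option linter.dupNamespace false

open scoped Manifold ContDiff Topology ContinuousMap
open Set
open Literature.Topology.FourManifolds
open Summit.SmoothPoincare4.SmoothPoincare4.Theses.WeakReductionDescent
open Summit.SmoothPoincare4.SmoothPoincare4.Theorems.MinimalWeaklyReducibleFromFour.KCap
  (stub_pigeonhole stub_twoSided helper_kcap_of_sectorHaken helper_fromFour_of_kcap isPreconnected_of_isCurve)
open Summit.SmoothPoincare4.SmoothPoincare4.Theorems.WeakReductionReduces.Negative
  (not_minimal_of_diffeomorph not_minimal_of_smoothPoincare4)

namespace Summit.SmoothPoincare4.SmoothPoincare4.Cruxes.MinimalWeaklyReducibleFromFour.Disproof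

/-- The round `4`-sphere. -/
local notation "𝕊⁴" => (Metric.sphere (0 : EuclideanSpace ℝ (Fin 5)) 1)

/-! ## §A  Shield of the crux (short; see BirthAttack.lean and Negative/RefutationCost.lean) -/

/-- `SmoothPoincare4 → X₂` by vacuity of "minimal of genus ≥ 4" on every `M ≅ S⁴`. [folklore] -/
theorem fromFour_of_spc4 (hs : _root_.SmoothPoincare4) : MinimalWeaklyReducibleFromFour := by
  intro M _ _ _ _ _ e g k T _hT hg hmin
  exact (not_minimal_of_smoothPoincare4 hs e (by omega) hmin).elim

/-- Refutation cost: `¬ X₂ → ¬ SmoothPoincare4`. [folklore] -/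
theorem not_spc4_of_not_fromFour (h : ¬ MinimalWeaklyReducibleFromFour) : ¬ _root_.SmoothPoincare4 :=
  fun hs => h (fromFour_of_spc4 hs)

/-- On the round sphere (and on every `M ≅ S⁴`) the crux's minimality hypothesis fails for `g ≥ 1`. [folklore] -/
theorem sphere_not_isMinimal {g : ℕ} (hg : 1 ≤ g)
    (hmin : ∀ (g' : ℕ) (k' : Fin 3 → ℕ) (T' : Fin 3 → Set 𝕊⁴), IsGKTrisection 𝕊⁴ g' k' T' → g ≤ g') : False :=
  not_minimal_of_diffeomorph (Diffeomorph.refl (𝓡 4) 𝕊⁴ ∞) hg hmin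

/-! ## §B  The line `Sketch` (spine KCap): the apex and what it costs -/

/-- **The apex `stub_sectorHaken`, verbatim** (registered signature of `Lines/Sketch.lean`). [folklore] -/
def SectorHaken : Prop :=
  ∀ (M : Type) [TopologicalSpace M] [T2Space M] [SecondCountableTopology M] [ChartedSpace (EuclideanSpace ℝ (Fin 4)) M] [IsManifold (𝓡 4) ((⊤ : ℕ∞) : WithTop ℕ∞) M], (M ≃ₕ (Metric.sphere (0 : EuclideanSpace ℝ (Fin 5)) 1)) → ∀ (g : ℕ) (k : Fin 3 → ℕ) (T : Fin 3 → Set M), Literature.Topology.FourManifolds.IsGKTrisection M g k T → 4 ≤ g → ∀ (p : Fin 3), 2 ≤ k p → ∃ (δ c₁ c₂ c : Set M), Literature.Topology.FourManifolds.Trisection.IsCurve T δ ∧ (∀ q : Fin 3, q ≠ p → Literature.Topology.FourManifolds.Trisection.BoundsDisc T (Literature.Topology.FourManifolds.Trisection.spineHandlebody T q) δ) ∧ (Literature.Topology.FourManifolds.Trisection.IsCurve T c₁ ∧ Literature.Topology.FourManifolds.Trisection.IsNonSeparating T c₁ ∧ ∀ q : Fin 3, q ≠ p → Literature.Topology.FourManifolds.Trisection.BoundsDisc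 T (Literature.Topology.FourManifolds.Trisection.spineHandlebody T q) c₁) ∧ (Literature.Topology.FourManifolds.Trisection.IsCurve T c₂ ∧ Literature.Topology.FourManifolds.Trisection.IsNonSeparating T c₂ ∧ ∀ q : Fin 3, q ≠ p → Literature.Topology.FourManifolds.Trisection.BoundsDisc T (Literature.Topology.FourManifolds.Trisection.spineHandlebody T q) c₂) ∧ Disjoint c₁ δ ∧ Disjoint c₂ δ ∧ (∀ S : Set M, S ⊆ Literature.Topology.FourManifolds.Trisection.centralSurfaceSet T \ δ → IsPreconnected S → c₁ ⊆ S → c₂ ⊆ S → False) ∧ Literature.Topology.FourManifolds.Trisection.IsCurve T c ∧ Literature.Topology.FourManifolds.Trisection.IsNonSeparating T c ∧ Literature.Topology.FourManifolds.Trisection.BoundsDisc T (Literature.Topology.FourManifolds.Trisection.spineHandlebody T p) c ∧ Disjoint c δ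

/-- **The apex restricted to the round sphere** (`M := S⁴`; `e` is then irrelevant). [folklore] -/
def SectorHakenSphere : Prop :=
  ∀ (g : ℕ) (k : Fin 3 → ℕ) (T : Fin 3 → Set 𝕊⁴), IsGKTrisection 𝕊⁴ g k T → 4 ≤ g → ∀ (p : Fin 3), 2 ≤ k p → ∃ (δ c₁ c₂ c : Set 𝕊⁴), Literature.Topology.FourManifolds.Trisection.IsCurve T δ ∧ (∀ q : Fin 3, q ≠ p → Literature.Topology.FourManifolds.Trisection.BoundsDisc T (Literature.Topology.FourManifolds.Trisection.spineHandlebody T q) δ) ∧ (Literature.Topology.FourManifolds.Trisection.IsCurve T c₁ ∧ Literature.Topology.FourManifolds.Trisection.IsNonSeparating T c₁ ∧ ∀ q : Fin 3, q ≠ p → Literature.Topology.FourManifolds.Trisection.BoundsDisc T (Literature.Topology.FourManifolds.Trisection.spineHandlebody T q) c₁) ∧ (Literature.Topology.FourManifolds.Trisection.IsCurve T c₂ ∧ Literature.Topology.FourManifolds.Trisection.IsNonSeparating T c₂ ∧ ∀ q : Fin 3, q ≠ p → Literature.Topology.FourManifolds.Trisection.BoundsDisc T (Literature.Topology.FourManifolds.Trisection.spineHandlebody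 T q) c₂) ∧ Disjoint c₁ δ ∧ Disjoint c₂ δ ∧ (∀ S : Set 𝕊⁴, S ⊆ Literature.Topology.FourManifolds.Trisection.centralSurfaceSet T \ δ → IsPreconnected S → c₁ ⊆ S → c₂ ⊆ S → False) ∧ Literature.Topology.FourManifolds.Trisection.IsCurve T c ∧ Literature.Topology.FourManifolds.Trisection.IsNonSeparating T c ∧ Literature.Topology.FourManifolds.Trisection.BoundsDisc T (Literature.Topology.FourManifolds.Trisection.spineHandlebody T p) c ∧ Disjoint c δ

/-- **KCap without minimality**: every GK-trisection of genus `≥ 4` of a smooth homotopy 4-sphere is weakly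
reducible — what the line actually proves from its stubs. [folklore] -/
def KCapNoMin : Prop :=
  ∀ (M : Type) [TopologicalSpace M] [T2Space M] [SecondCountableTopology M]
    [ChartedSpace (EuclideanSpace ℝ (Fin 4)) M] [IsManifold (𝓡 4) ∞ M],
    (M ≃ₕ 𝕊⁴) → ∀ (g : ℕ) (k : Fin 3 → ℕ) (T : Fin 3 → Set M), IsGKTrisection M g k T → 4 ≤ g →
      Trisection.IsWeaklyReducible T

/-- The apex gives `KCapNoMin` (pigeonhole + two-sidedness, both landed); minimality never enters. [folklore] -/
theorem kcapNoMin_of_sectorHaken (h : SectorHaken) : KCapNoMin := by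
  intro M _ _ _ _ _ e g k T hT hg
  obtain ⟨p, hp⟩ := stub_pigeonhole M e g k T hT hg
  exact helper_kcap_of_sectorHaken h M e g k T hT hg p hp

/-- `KCapNoMin → X₂` (discard minimality; `Iff.rfl` on the clause). [folklore] -/
theorem fromFour_of_kcapNoMin (h : KCapNoMin) : MinimalWeaklyReducibleFromFour := by
  intro M _ _ _ _ _ e g k T hT hg _hmin
  exact (Trisection.isWeaklyReducible_iff T).1 (h M e g k T hT hg)

/-- The apex restricts to the round sphere (`e := refl`). [folklore] -/
theorem sectorHakenSphere_of_sectorHaken (h : SectorHaken) : SectorHakenSphere :=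
  fun g k T hT hg p hp => h 𝕊⁴ (ContinuousMap.HomotopyEquiv.refl _) g k T hT hg p hp

/-- The central surface of Gay–Kirby's genus-`0` trisection of the round `S⁴` is nonempty (it is the
`2`-sphere `{z = 0}`; the point `(0, 0, 1, 0, 0)` lies on it). [cite: GayKirby2016, §2 (arXiv p. 5), first example] -/
theorem iInter_sphereSector_nonempty : (⋂ m, GayKirby.sphereSector m).Nonempty := by
  rw [GayKirby.iInter_sphereSector_eq]
  refine ⟨⟨EuclideanSpace.single 2 1, ?_⟩, ?_, ?_⟩
  · simp
  · simp
  · simp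

/-- **The round `S⁴` has a `(3; 1, 1, 1)` GK-trisection with nonempty central surface** (the genus-`0`
trisection stabilised once, Gay–Kirby Lemma 10 — both PROVED tree theorems). [cite: GayKirby2016, Def. 8 and Lemma 10] -/
theorem sphere_gkTrisection_three_one :
    ∃ T : Fin 3 → Set 𝕊⁴,
      IsGKTrisection 𝕊⁴ 3 (fun _ => 1) T ∧ (⋂ m, T m).Nonempty := by
  have h0 : IsGKTrisection 𝕊⁴ 0 (fun _ => 0) GayKirby.sphereSector :=
    sphereSector_isBalancedGKTrisection_holds.isGKTrisection
  obtain ⟨T₁, hT₁, hne₁⟩ := h0.exists_stabilization iInter_sphereSector_nonempty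
  exact ⟨T₁, by simpa using hT₁, hne₁⟩

/-- **The round `S⁴` has a `(6; 2, 2, 2)` GK-trisection with nonempty central surface** (stabilise
twice): genus `6 ≥ 4` and `k p = 2` at EVERY label `p`. [cite: GayKirby2016, Def. 8 and Lemma 10] -/
theorem sphere_gkTrisection_six_two :
    ∃ T : Fin 3 → Set 𝕊⁴,
      IsGKTrisection 𝕊⁴ 6 (fun _ => 2) T ∧ (⋂ m, T m).Nonempty := by
  obtain ⟨T₁, hT₁, hne₁⟩ := sphere_gkTrisection_three_one
  obtain ⟨T₂, hT₂, hne₂⟩ := hT₁.exists_stabilization hne₁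
  exact ⟨T₂, by simpa using hT₂, hne₂⟩

/-- **The apex binds on the round sphere.** The hypotheses of `stub_sectorHaken` — a smooth homotopy
4-sphere (here `S⁴` itself, `e = refl`), a GK-trisection of genus `≥ 4`, a label with `k p ≥ 2` — are
satisfiable on the ROUND `S⁴`, at every label: in contrast with the crux, whose minimality hypothesis
fails on every `M ≅ S⁴`, the summit does not make the apex vacuous. [folklore] -/
theorem sectorHaken_hypotheses_satisfiable :
    ∃ (_ : 𝕊⁴ ≃ₕ 𝕊⁴)
      (g : ℕ) (k : Fin 3 → ℕ) (T : Fin 3 → Set 𝕊⁴),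
      IsGKTrisection 𝕊⁴ g k T ∧ 4 ≤ g ∧ ∀ p : Fin 3, 2 ≤ k p := by
  obtain ⟨T, hT, -⟩ := sphere_gkTrisection_six_two
  exact ⟨ContinuousMap.HomotopyEquiv.refl _, 6, fun _ => 2, T, hT, by norm_num, fun _ => le_rfl⟩


/-- **What the apex decides about `S⁴`**: every GK-trisection of the ROUND sphere of genus `≥ 4` is weakly
reducible (open in print, AZ25 p. 27). [cite: ArandaZupan2025, §8 (p. 27)] -/
theorem sphere_isWeaklyReducible_of_sectorHaken (h : SectorHaken) :
    ∀ (g : ℕ) (k : Fin 3 → ℕ) (T : Fin 3 → Set 𝕊⁴), IsGKTrisection 𝕊⁴ g k T → 4 ≤ g →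
      Trisection.IsWeaklyReducible T :=
  fun g k T hT hg => kcapNoMin_of_sectorHaken h 𝕊⁴ (ContinuousMap.HomotopyEquiv.refl _) g k T hT hg

/-- A non-vacuous instance the apex settles: the (6;2,2,2) stabilisation of the round sphere is weakly
reducible (true on paper for this standard trisection — consistent, no lever). [folklore] -/
theorem sphere_six_isWeaklyReducible_of_sectorHaken (h : SectorHaken) :
    ∃ T : Fin 3 → Set 𝕊⁴, IsGKTrisection 𝕊⁴ 6 (fun _ => 2) T ∧ Trisection.IsWeaklyReducible T := by
  obtain ⟨T, hT, -⟩ := sphere_gkTrisection_six_two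
  exact ⟨T, hT, sphere_isWeaklyReducible_of_sectorHaken h 6 _ T hT (by norm_num)⟩

/-- **`SmoothPoincare4 →` (apex on the round `S⁴`) `→` apex.**  Push the trisection of `M` forward along
the diffeomorphism `Φ : M ≅ S⁴` the summit provides (`IsGKTrisection.image_diffeomorph'`), take the
configuration `(δ, c₁, c₂, c)` there, and pull it back along `Φ⁻¹`: curves, compressing discs,
non-separation, disjointness and the two-sides clause are natural under diffeomorphisms
(`WeaklyReducibleTrisectionsNaturality.lean`).  So the summit reduces the apex to — but does not settle —
a statement about `S⁴`'s own genus-`≥ 4` trisections. [cite: ArandaZupan2025, §2 (p. 6)] -/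
theorem sectorHaken_of_sphere_of_smoothPoincare4 (hs : _root_.SmoothPoincare4)
    (hS : SectorHakenSphere) :
    SectorHaken := by
  unfold SectorHaken
  intro M _ _ _ _ _ e g k T hT hg p hp
  obtain ⟨Φ⟩ := hs M ‹_› ‹_› e
  -- push forward
  set T' : Fin 3 → Set (Metric.sphere (0 : EuclideanSpace ℝ (Fin 5)) 1) := fun i => Φ '' T i with hT'def
  have hT' : IsGKTrisection (Metric.sphere (0 : EuclideanSpace ℝ (Fin 5)) 1) g k T' :=
    hT.image_diffeomorph' Φ
  obtain ⟨δ', c₁', c₂', c', hδ', hδ'b, hc₁', hc₂', hd₁', hd₂', hsides', hc', hc'ns, hc'b, hc'δ⟩ :=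
    hS g k T' hT' hg p hp
  -- pull back along `Ψ = Φ.symm`
  have hinjΦ : Function.Injective Φ := EquivLike.injective Φ
  have hinjΨ : Function.Injective Φ.symm := EquivLike.injective Φ.symm
  have hback : (fun i => Φ.symm '' T' i) = T := by
    funext i
    simp [hT'def, Set.image_image]
  have hΦΨ : ∀ s : Set (Metric.sphere (0 : EuclideanSpace ℝ (Fin 5)) 1), Φ '' (Φ.symm '' s) = s := by
    intro s
    simp [Set.image_image]
  -- transport of the four kinds of clauses
  have curve : ∀ {a}, Trisection.IsCurve T' a → Trisection.IsCurve T (Φ.symm '' a) := by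
    intro a ha
    have h := ha.image_diffeomorph Φ.symm
    rwa [hback] at h
  have disc : ∀ {a} (q : Fin 3), Trisection.BoundsDisc T' (Trisection.spineHandlebody T' q) a →
      Trisection.BoundsDisc T (Trisection.spineHandlebody T q) (Φ.symm '' a) := by
    intro a q ha
    have h := ha.image_diffeomorph Φ.symm
    rw [← Trisection.spineHandlebody_image T' hinjΨ q, hback] at h
    exact h
  have nonsep : ∀ {a}, Trisection.IsNonSeparating T' a → Trisection.IsNonSeparating T (Φ.symm '' a) := by
    intro a ha
    have h := ha.image_homeomorph Φ.symm.toHomeomorph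
    simp only [Diffeomorph.coe_toHomeomorph] at h
    rwa [hback] at h
  have disj : ∀ {a b : Set (Metric.sphere (0 : EuclideanSpace ℝ (Fin 5)) 1)}, Disjoint a b →
      Disjoint (Φ.symm '' a) (Φ.symm '' b) := fun h => (Set.disjoint_image_iff hinjΨ).2 h
  refine ⟨Φ.symm '' δ', Φ.symm '' c₁', Φ.symm '' c₂', Φ.symm '' c', curve hδ', fun q hq => disc q (hδ'b q hq),
    ⟨curve hc₁'.1, nonsep hc₁'.2.1, fun q hq => disc q (hc₁'.2.2 q hq)⟩,
    ⟨curve hc₂'.1, nonsep hc₂'.2.1, fun q hq => disc q (hc₂'.2.2 q hq)⟩, disj hd₁', disj hd₂', ?_,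
    curve hc', nonsep hc'ns, disc p hc'b, disj hc'δ⟩
  -- the two-sides clause
  intro S hS hSpc h₁ h₂
  refine hsides' (Φ '' S) ?_ (hSpc.image Φ Φ.continuous.continuousOn) ?_ ?_
  · rintro _ ⟨x, hx, rfl⟩
    obtain ⟨hxF, hxδ⟩ := hS hx
    refine ⟨?_, fun hΦx => hxδ ⟨Φ x, hΦx, by simp⟩⟩
    rw [Trisection.centralSurfaceSet_image T (EquivLike.bijective Φ)]
    exact mem_image_of_mem Φ hxF
  · calc c₁' = Φ '' (Φ.symm '' c₁') := (hΦΨ c₁').symm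
      _ ⊆ Φ '' S := image_mono h₁
  · calc c₂' = Φ '' (Φ.symm '' c₂') := (hΦΨ c₂').symm
      _ ⊆ Φ '' S := image_mono h₂


/-- Under the summit the apex and its sphere restriction are equivalent. [folklore] -/
theorem sectorHaken_iff_sphere_of_smoothPoincare4 (hs : _root_.SmoothPoincare4) :
    SectorHaken ↔ SectorHakenSphere :=
  ⟨sectorHakenSphere_of_sectorHaken, sectorHaken_of_sphere_of_smoothPoincare4 hs⟩

/-- **Two-sides clause read-back**: `δ` is separating on `F`, the cores are disjoint and distinct. [folklore] -/
theorem sides_consequences {M : Type} [TopologicalSpace M]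
    [ChartedSpace (EuclideanSpace ℝ (Fin 4)) M] {T : Fin 3 → Set M} {δ c₁ c₂ : Set M}
    (hc₁ : Trisection.IsCurve T c₁) (hc₂ : Trisection.IsCurve T c₂) (hd₁ : Disjoint c₁ δ)
    (hd₂ : Disjoint c₂ δ)
    (hsides : ∀ S : Set M, S ⊆ Trisection.centralSurfaceSet T \ δ → IsPreconnected S → c₁ ⊆ S → c₂ ⊆ S → False) :
    ¬ Trisection.IsNonSeparating T δ ∧ Disjoint c₁ c₂ := by
  have h₁F : c₁ ⊆ Trisection.centralSurfaceSet T \ δ :=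
    fun z hz => ⟨hc₁.1 hz, fun hzδ => Set.disjoint_left.1 hd₁ hz hzδ⟩
  have h₂F : c₂ ⊆ Trisection.centralSurfaceSet T \ δ :=
    fun z hz => ⟨hc₂.1 hz, fun hzδ => Set.disjoint_left.1 hd₂ hz hzδ⟩
  refine ⟨fun hns => hsides _ subset_rfl hns.isPreconnected h₁F h₂F, ?_⟩
  by_contra hnd
  obtain ⟨x, hx₁, hx₂⟩ := Set.not_disjoint_iff.1 hnd
  exact hsides (c₁ ∪ c₂) (union_subset h₁F h₂F)
    ((isPreconnected_of_isCurve hc₁).union x hx₁ hx₂ (isPreconnected_of_isCurve hc₂))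
    subset_union_left subset_union_right

/-- **`_false_without_` the trisection hypothesis (formal, junk witness).** [folklore] -/
def SectorHakenWithoutTrisection : Prop :=
  ∀ (M : Type) [TopologicalSpace M] [T2Space M] [SecondCountableTopology M] [ChartedSpace (EuclideanSpace ℝ (Fin 4)) M] [IsManifold (𝓡 4) ((⊤ : ℕ∞) : WithTop ℕ∞) M], (M ≃ₕ (Metric.sphere (0 : EuclideanSpace ℝ (Fin 5)) 1)) → ∀ (g : ℕ) (k : Fin 3 → ℕ) (T : Fin 3 → Set M), 4 ≤ g → ∀ (p : Fin 3), 2 ≤ k p → ∃ (δ c₁ c₂ c : Set M), Literature.Topology.FourManifolds.Trisection.IsCurve T δ ∧ (∀ q : Fin 3, q ≠ p → Literature.Topology.FourManifolds.Trisection.BoundsDisc T (Literature.Topology.FourManifolds.Trisection.spineHandlebody T q) δ) ∧ (Literature.Topology.FourManifolds.Trisection.IsCurve T c₁ ∧ Literature.Topology.FourManifolds.Trisection.IsNonSeparating T c₁ ∧ ∀ q : Fin 3, q ≠ p → Literature.Topology.FourManifolds.Trisection.BoundsDisc T (Literature.Topology.FourManifolds.Trisection.spineHandlebody T q) c₁)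 ∧ (Literature.Topology.FourManifolds.Trisection.IsCurve T c₂ ∧ Literature.Topology.FourManifolds.Trisection.IsNonSeparating T c₂ ∧ ∀ q : Fin 3, q ≠ p → Literature.Topology.FourManifolds.Trisection.BoundsDisc T (Literature.Topology.FourManifolds.Trisection.spineHandlebody T q) c₂) ∧ Disjoint c₁ δ ∧ Disjoint c₂ δ ∧ (∀ S : Set M, S ⊆ Literature.Topology.FourManifolds.Trisection.centralSurfaceSet T \ δ → IsPreconnected S → c₁ ⊆ S → c₂ ⊆ S → False) ∧ Literature.Topology.FourManifolds.Trisection.IsCurve T c ∧ Literature.Topology.FourManifolds.Trisection.IsNonSeparating T c ∧ Literature.Topology.FourManifolds.Trisection.BoundsDisc T (Literature.Topology.FourManifolds.Trisection.spineHandlebody T p) c ∧ Disjoint c δ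

theorem sectorHaken_false_without_trisection : ¬ SectorHakenWithoutTrisection := by
  intro h
  obtain ⟨δ, c₁, c₂, c, hδ, -⟩ := h 𝕊⁴ (ContinuousMap.HomotopyEquiv.refl _) 4 (fun _ => 2) (fun _ => ∅) le_rfl 0 le_rfl
  obtain ⟨hδF, γ, -, hγ⟩ := hδ
  have hF : Trisection.centralSurfaceSet (fun _ : Fin 3 => (∅ : Set 𝕊⁴)) = ∅ := iInter_const _
  obtain ⟨x, hx⟩ := (NormedSpace.sphere_nonempty (x := (0 : EuclideanSpace ℝ (Fin 2))) (r := 1)).mpr zero_le_one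
  have hmem : γ ⟨x, hx⟩ ∈ δ := hγ ▸ mem_range_self _
  have : γ ⟨x, hx⟩ ∈ (∅ : Set 𝕊⁴) := hF ▸ hδF hmem
  exact this

/-! ## §C  Near-misses (paper witnesses; `sorry` permitted only here) -/

/-- **The apex with `2 ≤ k p` dropped** (every label). [folklore] -/
def SectorHakenWithoutKp : Prop :=
  ∀ (M : Type) [TopologicalSpace M] [T2Space M] [SecondCountableTopology M] [ChartedSpace (EuclideanSpace ℝ (Fin 4)) M] [IsManifold (𝓡 4) ((⊤ : ℕ∞) : WithTop ℕ∞) M], (M ≃ₕ (Metric.sphere (0 : EuclideanSpace ℝ (Fin 5)) 1)) → ∀ (g : ℕ) (k : Fin 3 → ℕ) (T : Fin 3 → Set M), Literature.Topology.FourManifolds.IsGKTrisection M g k T → 4 ≤ g → ∀ (p : Fin 3), ∃ (δ c₁ c₂ c : Set M), Literature.Topology.FourManifolds.Trisection.IsCurve T δ ∧ (∀ q : Fin 3, q ≠ p → Literature.Topology.FourManifolds.Trisection.BoundsDisc T (Literature.Topology.FourManifolds.Trisection.spineHandlebody T q) δ) ∧ (Literature.Topology.FourManifolds.Trisection.IsCurve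 T c₁ ∧ Literature.Topology.FourManifolds.Trisection.IsNonSeparating T c₁ ∧ ∀ q : Fin 3, q ≠ p → Literature.Topology.FourManifolds.Trisection.BoundsDisc T (Literature.Topology.FourManifolds.Trisection.spineHandlebody T q) c₁) ∧ (Literature.Topology.FourManifolds.Trisection.IsCurve T c₂ ∧ Literature.Topology.FourManifolds.Trisection.IsNonSeparating T c₂ ∧ ∀ q : Fin 3, q ≠ p → Literature.Topology.FourManifolds.Trisection.BoundsDisc T (Literature.Topology.FourManifolds.Trisection.spineHandlebody T q) c₂) ∧ Disjoint c₁ δ ∧ Disjoint c₂ δ ∧ (∀ S : Set M, S ⊆ Literature.Topology.FourManifolds.Trisection.centralSurfaceSet T \ δ → IsPreconnected S → c₁ ⊆ S → c₂ ⊆ S → False) ∧ Literature.Topology.FourManifolds.Trisection.IsCurve T c ∧ Literature.Topology.FourManifolds.Trisection.IsNonSeparating T c ∧ Literature.Topology.FourManifolds.Trisection.BoundsDisc T (Literature.Topology.FourManifolds.Trisection.spineHandlebody T p) c ∧ Disjoint c δ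

/-- **`2 ≤ k p` is load-bearing (PAPER).**  Witness: the (4;2,1,1) stabilisation of the round `S⁴` at the
label `p = 1` (`k 1 = 1`): `∂X_1 ≅ S¹ × S²`; the two-sides clause needs a SEPARATING reducing curve `δ` of
its genus-4 splitting with a core on each side (`sides_consequences`), but a separating 2-sphere in the prime
`S¹ × S²` bounds a punctured `S³`, and a curve compressing to both sides of a Heegaard surface of `S³` is
separating in it, hence (capping) separating in `F` — no core on that side.  OBSTRUCTION to formalising:
needs primeness of `S¹ × S²`, Alexander/Schoenflies in `S³` and Jordan on `F`; none is in the tree.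
Tried: nothing formal beyond the junk witness (empty sectors are excluded here by `IsGKTrisection`). -/
theorem sectorHaken_false_without_kp : ¬ SectorHakenWithoutKp := by
  sorry

/-- **The crux with `e : M ≃ₕ S⁴` dropped** (all closed smooth 4-manifolds over the bare binders). [folklore] -/
def FromFourWithoutHomotopyEquiv : Prop :=
  ∀ (M : Type) [TopologicalSpace M] [T2Space M] [SecondCountableTopology M]
    [ChartedSpace (EuclideanSpace ℝ (Fin 4)) M] [IsManifold (𝓡 4) ∞ M],
    ∀ (g : ℕ) (k : Fin 3 → ℕ) (T : Fin 3 → Set M), IsGKTrisection M g k T → 4 ≤ g →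
      (∀ (g' : ℕ) (k' : Fin 3 → ℕ) (T' : Fin 3 → Set M), IsGKTrisection M g' k' T' → g ≤ g') →
      Trisection.IsWeaklyReducible T

/-- **`e` is load-bearing (PAPER; BirthAttack's mutation finding made a target).**  Witness `#⁴ℂP²` with any
genus-4 trisection (type (4;0,0,0) by `χ = 6 = 2 + g − Σk`; minimal since `g ≥ b₂ = 4`): with `Σk = 0`
every sector boundary is `S³`, and a non-separating curve compressing to both sides of a Heegaard surface of
`S³` does not exist, so NO weak reduction (the definition demands a non-separating `c′` compressing in two
handlebodies).  OBSTRUCTION: `ℂP²`, its trisection and the separation lemma are not in the tree. -/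
theorem fromFour_false_without_homotopyEquiv : ¬ FromFourWithoutHomotopyEquiv := by
  sorry

/-- **Waldhausen-4D shield of the apex (PAPER, recipe in the module docstring §B).**  Stated with the
standardness hypothesis abstracted as "every GK-trisection of the round sphere with a label `k p ≥ 2` carries
the configuration" would be circular; the honest formal target is `Waldhausen4D → SectorHakenSphere` once a
tree notion of "standard / stabilised trisection up to diffeomorphism" exists (none does: the tree has
`exists_stabilization` as an existence theorem, not a recognition predicate).  Recorded as the statement the
lead should NOT expect to refute on `S⁴`. [folklore] -/
theorem sectorHakenSphere_expected : SectorHakenSphere := by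
  sorry

end Summit.SmoothPoincare4.SmoothPoincare4.Cruxes.MinimalWeaklyReducibleFromFour.Disproof

end
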